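import Summits.FinalStateConjecture.FinalStateConjecture.Theorems.BartnikGapSettlingBondiBartnikRigidityMarchingLemmaKiteTopology
import Summits.FinalStateConjecture.FinalStateConjecture.Theorems.BartnikGapSettlingBondiBartnikRigidityMarchingLemmaLevelData
import Summits.FinalStateConjecture.FinalStateConjecture.Theorems.PhaseMixingCaptureCaptureSufficesC2StubHypersurfaceMGHDRealisedCBG
import Literature.Geometry.Lorentzian.RelativeDevelopmentGluingCauchy
import Literature.Geometry.Lorentzian.MGHDUniqueness
import Literature.Geometry.Lorentzian.KerrRicciFlat
import HarnessLib

/-!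
# K2b-5 `stub_marchingLemma`, brick 6: the kite development is realised inside the maximal
# development over the slice datum — line `direct-method-on-the-cone` (crux `BondiBartnikRigidity`)

The ENGINE step of the marching (report K2b-a2 §4).  Data: a maximal vacuum Cauchy development `𝒱`, a
connected slice piece `N ⊆ E3` with its level-`σ` embedding `j_K : y ↦ (σ, y)` and normal `ν_K` in the
Kerr star chart (`…MarchingLemmaLevelData`), the KITE `K` over `{σ} × N` (`…MarchingLemmaKiteCauchy/Topology`,
by its membership predicate), and on the `𝒱` side a smooth embedding `j : N → 𝒱` with future unit normal
`ν` inducing the sub-datum `D' = ι^* Kerr.data`, with ACAUSAL image (in the marching `j = Ψ ∘ lab ∘ j_K`,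
`…MarchingLemmaChartData`; acausality by `ExactChartPastSet`).
* `kite_realised` — under `choquetBruhat_geroch_exists_mghd_cauchy`: the Kerr metric on `K` with
  `(j_K, ν_K)` is a vacuum Cauchy development `𝒦` of `D'`; the maximal development of `D'` realised in `𝒱`
  over `j` (engine `CaptureSufficesC2.Sketch.stub_hypersurfaceMGHDRealised_of_choquetBruhatGeroch`) receives
  `𝒦` by maximality; the composite `Θ : K → 𝒱` is a smooth isometric time-orientation preserving open
  embedding with `Θ ∘ j_K = j`, mapping the upper kite into `I⁺(j N)`;
* `kite_chart_unique` — RIGIDITY on the sub-kite `K ∩ {t* < σ + h'}` (`DataEmbedding.eq_of_comp_embed_eq`).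

References: Choquet-Bruhat–Geroch 1969, Thm. 3 [ChoquetBruhatGeroch1969CMP]; Hawking–Ellis 1973, §7.6
[HawkingEllis1973CUP]; Sbierski 2016, §3.1 [Sbierski2016AHP].  No definitions, no new named facts.
-/

noncomputable section

set_option linter.dupNamespace false
set_option maxSynthPendingDepth 3

open Set Filter Function Topology TopologicalSpace Bundle Literature.Geometry.Lorentzian
open scoped Manifold ContDiff Topology

namespace Summit.FinalStateConjecture.FinalStateConjecture.Theorems.BondiBartnikRigidity.DirectMethod

namespace KiteRealise

open Summit.FinalStateConjecture.FinalStateConjecture.Theorems.CaptureSufficesC2.Sketch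
  (stub_hypersurfaceMGHDRealised_of_choquetBruhatGeroch)

variable {X : Type} [TopologicalSpace X] [ChartedSpace E3 X] [IsManifold (𝓡 3) ∞ X]
  [T2Space X] [SecondCountableTopology X] [ConnectedSpace X] {D : InitialDataSet (𝓡 3) X}

/-- The slice points `j_K y` lie in the kite (in `K⁺`, at radius `0`). [folklore] -/
theorem level_mem_kite {M a : ℝ} {σ hp hm : ℝ} (hhp : 0 < hp) {N : Opens E3} {W : Set (Kerr.region a M)}
    {jK : N → Kerr.region a M} (hjK : ∀ y, (jK y : E4) = E4.ofTimeSpace σ (y : E3)) (y : N) :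
    (σ ≤ (jK y : E4) 0 ∧ (jK y : E4) 0 < σ + hp ∧ ∀ z : E3, ‖z - E4.spatial (jK y : E4)‖ ≤ (jK y : E4) 0 - σ →
        min (Kerr.radius a (jK y : E4)) (Kerr.rPlus M a) ≤ Kerr.radius a (E4.ofTimeSpace 0 z) → z ∈ (N : Set E3)) ∨
      (jK y ∈ W ∧ σ - hm < (jK y : E4) 0 ∧ (jK y : E4) 0 < σ ∧
        σ + 2 / 3 * M < (jK y : E4) 0 + 2 / 3 * Kerr.radius a (jK y : E4) ∧
        ∀ z : E3, ‖z - E4.spatial (jK y : E4)‖ ≤ σ - (jK y : E4) 0 → z ∈ (N : Set E3)) := by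
  refine Or.inl ⟨by rw [hjK]; simp, by rw [hjK]; simpa using hhp, fun z hz _ => ?_⟩
  rw [hjK] at hz
  simp only [E4.ofTimeSpace_apply_zero, sub_self, E4.spatial_ofTimeSpace, norm_le_zero_iff, sub_eq_zero] at hz
  rw [hz]; exact y.2

/-- **The kite development is realised inside the maximal development over the slice datum** (module
docstring): a smooth isometric time-orientation preserving open embedding `Θ : K → 𝒱` with
`Θ (σ, y) = j y` and `Θ (K ∩ {t* > σ}) ⊆ I⁺_𝒱(j N)`.
[cite: ChoquetBruhatGeroch1969CMP, Thm. 3] [cite: HawkingEllis1973CUP, §7.6, pp. 249–251] -/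
theorem kite_realised (hcbg : choquetBruhat_geroch_exists_mghd_cauchy)
    [Kerr.Facts] [Kerr.SliceFacts] (𝒱 : VacuumCauchyDevelopment D) (hmax : 𝒱.IsMaximal)
    {M a : ℝ} (hM0 : 0 < M) (ha : |a| < M) {σ hp hm : ℝ} (hhp : 0 < hp)
    (N : Opens E3) (hNc : IsConnected (N : Set E3)) (hN : N ≤ Kerr.slice a M)
    {W : Set (Kerr.region a M)}
    (hW : ∀ x ∈ W, (Kerr.smoothMetric M a M).chronologicalFuture
      ((Kerr.timeOrientation M a M hM0.le).ofLE le_top) {x} ⊆ W)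
    (hWup : ∀ y ∈ W, ∀ u : ℝ, 0 ≤ u →
      (⟨(y : E4) + u • E4.basisVector 0, Kerr.add_smul_basisVector_zero_mem_region y.2 u⟩ : Kerr.region a M) ∈ W)
    (U : Opens (Kerr.spacetime M a M hM0.le).carrier)
    (hU : ∀ y : Kerr.region a M, y ∈ U ↔
      (σ ≤ (y : E4) 0 ∧ (y : E4) 0 < σ + hp ∧ ∀ z : E3, ‖z - E4.spatial (y : E4)‖ ≤ (y : E4) 0 - σ →
        min (Kerr.radius a (y : E4)) (Kerr.rPlus M a) ≤ Kerr.radius a (E4.ofTimeSpace 0 z) → z ∈ (N : Set E3)) ∨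
      (y ∈ W ∧ σ - hm < (y : E4) 0 ∧ (y : E4) 0 < σ ∧
        σ + 2 / 3 * M < (y : E4) 0 + 2 / 3 * Kerr.radius a (y : E4) ∧
        ∀ z : E3, ‖z - E4.spatial (y : E4)‖ ≤ σ - (y : E4) 0 → z ∈ (N : Set E3)))
    {jK : N → Kerr.region a M} (hjK : ∀ y, (jK y : E4) = E4.ofTimeSpace σ (y : E3))
    {νK : NormalField 𝓘(ℝ, E4) jK} (hνK : ∀ y, νK y = Kerr.sliceNormal M a M (Opens.inclusion hN y))
    [ConnectedSpace N]
    {j : N → 𝒱.carrier} {ν : NormalField (𝓡 4) j}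
    (hj : Manifold.IsSmoothEmbedding (𝓡 3) (𝓡 4) ∞ j)
    (hν : 𝒱.metric.IsFutureUnitNormal (𝓡 3) 𝒱.timeOrientation j ν)
    (hh : ∀ y : N, pullbackBilin (I := 𝓡 4) (I' := 𝓡 3) j 𝒱.metric.val y =
      ((Kerr.data M a M hM0.le).comap (Opens.inclusion hN) (contMDiff_inclusion hN)
        (KerrLevel.injective_mfderiv_inclusion hN)).h.inner y)
    (hk : ∀ [𝒱.metric.toPseudoRiemannianMetric.HasLeviCivita] (y : N),
      𝒱.metric.toPseudoRiemannianMetric.secondFundamentalForm (𝓡 3) j ν y =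
        ((Kerr.data M a M hM0.le).comap (Opens.inclusion hN) (contMDiff_inclusion hN)
          (KerrLevel.injective_mfderiv_inclusion hN)).kBilin y)
    (hac : ∀ p ∈ Set.range j, ∀ q ∈ Set.range j, q ∈ 𝒱.metric.causalFuture 𝒱.timeOrientation {p} → q = p) :
    ∃ Θ : U → 𝒱.carrier, ContMDiff 𝓘(ℝ, E4) (𝓡 4) ∞ Θ ∧ IsOpenEmbedding Θ ∧
      ((Kerr.spacetime M a M hM0.le).metric.restrict PseudoRiemannianMetric.contMDiff_restrict_holds
        U).IsIsometricImmersion 𝒱.metric.toPseudoRiemannianMetric Θ ∧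
      ((Kerr.spacetime M a M hM0.le).timeOrientation.restrict PseudoRiemannianMetric.contMDiff_restrict_holds
        (Kerr.spacetime M a M hM0.le).timeOrientation.contMDiff_restrict_holds U).PreservesTimeOrientation
        Θ 𝒱.timeOrientation ∧
      (∀ (y : N) (h : jK y ∈ U), Θ ⟨jK y, h⟩ = j y) ∧
      (∀ z : U, σ < (z.1.1 : E4) 0 →
        Θ z ∈ 𝒱.metric.chronologicalFuture 𝒱.timeOrientation (Set.range j)) := by
  -- the level data embedding in the Kerr star chart
  let 𝒮K : DataEmbedding ((Kerr.data M a M hM0.le).comap (Opens.inclusion hN) (contMDiff_inclusion hN)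
      (KerrLevel.injective_mfderiv_inclusion hN)) :=
    { toSpacetime := Kerr.spacetime M a M hM0.le
      embed := jK
      isSmoothEmbedding := KerrLevel.level_isSmoothEmbedding hM0.le σ hN hjK
      normal := νK
      isFutureUnitNormal := KerrLevel.level_isFutureUnitNormal hM0.le σ hN hjK hνK
      induced_h := KerrLevel.level_induced_h hM0.le σ hN hjK
      induced_k := by
        intro inst y
        haveI : (Kerr.smoothMetric M a M).HasLeviCivita := inst
        exact KerrLevel.level_induced_k hM0.le σ hN hjK hνK y }
  have hvac : 𝒮K.IsVacuum := by
    intro instLC x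
    haveI : (Kerr.metric M a M).HasLeviCivita := instLC
    exact Kerr.ricci_smoothMetric M a M x
  -- the slice lies in the kite; the kite is connected; the slice is its Cauchy hypersurface
  have hιU : ∀ y, 𝒮K.embed y ∈ U := fun y => (hU _).2 (level_mem_kite hhp hjK y)
  have hSr : ∀ z ∈ (N : Set E3), E4.ofTimeSpace σ z ∈ Kerr.region a M := fun z hz => by
    rw [Kerr.mem_region, Kerr.radius_eq_of_spatial_eq a
      (show E4.spatial (E4.ofTimeSpace σ z) = E4.spatial (E4.ofTimeSpace 0 z) by
        rw [E4.spatial_ofTimeSpace, E4.spatial_ofTimeSpace])]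
    exact Kerr.mem_slice_iff_ofTimeSpace_mem_region.1 (hN hz)
  have hUconn : IsConnected (U : Set (Kerr.spacetime M a M hM0.le).carrier) := by
    have h := KerrKite.isConnected_kite (M := M) (a := a) (σ := σ) (hm := hm) (W := W) hhp hNc hSr hWup
    have h' : (U : Set (Kerr.spacetime M a M hM0.le).carrier) = {y : Kerr.region a M |
      (σ ≤ (y : E4) 0 ∧ (y : E4) 0 < σ + hp ∧ ∀ z : E3, ‖z - E4.spatial (y : E4)‖ ≤ (y : E4) 0 - σ →
        min (Kerr.radius a (y : E4)) (Kerr.rPlus M a) ≤ Kerr.radius a (E4.ofTimeSpace 0 z) → z ∈ (N : Set E3)) ∨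
      (y ∈ W ∧ σ - hm < (y : E4) 0 ∧ (y : E4) 0 < σ ∧
        σ + 2 / 3 * M < (y : E4) 0 + 2 / 3 * Kerr.radius a (y : E4) ∧
        ∀ z : E3, ‖z - E4.spatial (y : E4)‖ ≤ σ - (y : E4) 0 → z ∈ (N : Set E3))} :=
      Set.ext fun y => hU y
    rw [h']; exact h
  have hrange : Set.range (𝒮K.embedOpens U hιU) = Subtype.val ⁻¹' {y : Kerr.region a M | y.1 0 = σ} := by
    ext z
    constructor
    · rintro ⟨y, rfl⟩
      show ((jK y : Kerr.region a M) : E4) 0 = σ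
      rw [hjK]; rfl
    · intro hz
      have hzS := KerrKite.spatial_mem_of_mem_kite_of_time_eq hM0 U hU z.2 hz
      refine ⟨⟨E4.spatial (z.1.1 : E4), hzS⟩, Subtype.ext (Subtype.ext ?_)⟩
      show ((jK ⟨E4.spatial (z.1.1 : E4), hzS⟩ : Kerr.region a M) : E4) = (z.1.1 : E4)
      rw [hjK]
      have hz' : (z.1.1 : E4) 0 = σ := hz
      conv_rhs => rw [← E4.ofTimeSpace_time_spatial (z.1.1 : E4)]
      rw [E4.time_apply, hz']
  have hCauchy := KerrKite.isCauchyHypersurface_kite hM0 ha hhp hW U hU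
  let 𝒦 : VacuumCauchyDevelopment ((Kerr.data M a M hM0.le).comap (Opens.inclusion hN)
      (contMDiff_inclusion hN) (KerrLevel.injective_mfderiv_inclusion hN)) :=
    { toDataEmbedding := 𝒮K.restrict U hUconn hιU (KerrLevel.level_mdifferentiableAt_normal hM0.le σ hN hjK hνK)
      isCauchyHypersurface := by
        show ((𝒮K.metric.restrict PseudoRiemannianMetric.contMDiff_restrict_holds U).IsCauchyHypersurface
          (𝒮K.timeOrientation.restrict PseudoRiemannianMetric.contMDiff_restrict_holds
            𝒮K.timeOrientation.contMDiff_restrict_holds U) (Set.range (𝒮K.embedOpens U hιU)))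
        rw [hrange]
        exact hCauchy
      isRicciFlat := by
        intro instLC
        haveI : (𝒮K.metric.restrict PseudoRiemannianMetric.contMDiff_restrict_holds
            U).toPseudoRiemannianMetric.HasLeviCivita := instLC
        exact 𝒮K.isRicciFlat_restrict U hvac }
  -- the `𝒱`-side data embedding and the engine
  obtain ⟨𝒟', h𝒟'max, χ, hχs, hχo, hχi, hχt, hχc⟩ :=
    stub_hypersurfaceMGHDRealised_of_choquetBruhatGeroch hcbg X D 𝒱 hmax N
      ((Kerr.data M a M hM0.le).comap (Opens.inclusion hN) (contMDiff_inclusion hN)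
        (KerrLevel.injective_mfderiv_inclusion hN)) j ν hj hν hh hk hac
  -- maximality of `𝒟'` receives the kite development
  obtain ⟨θ, hθs, hθo, hθi, hθt, hθc⟩ := h𝒟'max 𝒦
  have hθd : MDifferentiable 𝓘(ℝ, E4) (𝓡 4) θ := hθs.mdifferentiable (by simp)
  have hχd : MDifferentiable (𝓡 4) (𝓡 4) χ := hχs.mdifferentiable (by simp)
  have hΘi : 𝒦.metric.IsIsometricImmersion 𝒱.metric.toPseudoRiemannianMetric (χ ∘ θ) := hχi.comp hθi
  have hΘt : 𝒦.timeOrientation.PreservesTimeOrientation (χ ∘ θ) 𝒱.timeOrientation :=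
    hχt.comp hθt hχi.2 hχd hθd
  refine ⟨χ ∘ θ, hχs.comp hθs, hχo.comp hθo, hΘi, hΘt, fun y h => ?_, fun z hz => ?_⟩
  · -- `Θ ∘ j_K = j`
    have h1 : θ (𝒦.embed y) = 𝒟'.embed y := congrFun hθc y
    have h2 : χ (𝒟'.embed y) = j y := congrFun hχc y
    show χ (θ ⟨jK y, h⟩) = j y
    rw [← h2, ← h1]
    rfl
  · -- the upper kite is mapped into `I⁺(j N)`
    have hup : z ∈ (𝒦.metric).chronologicalFuture 𝒦.timeOrientation (Set.range 𝒦.embed) := by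
      show z ∈ ((𝒮K.metric.restrict PseudoRiemannianMetric.contMDiff_restrict_holds U).chronologicalFuture
          (𝒮K.timeOrientation.restrict PseudoRiemannianMetric.contMDiff_restrict_holds
            𝒮K.timeOrientation.contMDiff_restrict_holds U) (Set.range (𝒮K.embedOpens U hιU)))
      rw [hrange]
      exact KerrKite.upper_subset_chronologicalFuture_kite hM0 ha hhp hW U hU hz
    obtain ⟨p, ⟨y, rfl⟩, γ, t₀, t₁, ht, hγ, hγ0, hγ1⟩ := hup
    refine ⟨j y, ⟨y, rfl⟩, (χ ∘ θ) ∘ γ, t₀, t₁, ht,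
      hγ.comp_isIsometricImmersion ((hχs.comp hθs).mdifferentiable (by simp)) hΘt hΘi.2, ?_, ?_⟩
    · show χ (θ (γ t₀)) = j y
      rw [hγ0, ← show χ (𝒟'.embed y) = j y from congrFun hχc y, ← show θ (𝒦.embed y) = 𝒟'.embed y from congrFun hθc y]
    · show χ (θ (γ t₁)) = χ (θ z)
      rw [hγ1]

omit [T2Space X] [SecondCountableTopology X] in
/-- **Rigidity on the sub-kite: two isometric time-orientation preserving immersions of the kite
`K ∩ {t* < σ + h'}` into `𝒱` agreeing with `j` on the slice coincide** (`DataEmbedding.eq_of_comp_embed_eq`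
for the Kerr metric on the sub-kite — a data embedding of the sub-datum, connected by
`KerrKite.isConnected_kite` — and the `𝒱`-side data embedding `(𝒱, j, ν)`).  The two immersions are
handed over as `Θ` on the kite `U` (restricted) and as a map `Φ` of the Kerr chart, smooth and isometric
in chart form at the points of the sub-kite and pushing the Kerr-star orientation to future-directed
vectors there (in the marching: `Φ = Ψ ∘ lab` for the old exact chart `Ψ`).
[cite: Sbierski2016AHP, §3.1, corollary to the first lemma] -/
theorem kite_chart_unique [Kerr.Facts] [Kerr.SliceFacts] (𝒱 : VacuumCauchyDevelopment D)
    {M a : ℝ} (hM0 : 0 < M) {σ hp hm hp' : ℝ} (hhp' : 0 < hp') (hp'le : hp' ≤ hp)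
    (N : Opens E3) (hNc : IsConnected (N : Set E3)) (hN : N ≤ Kerr.slice a M)
    {W : Set (Kerr.region a M)}
    (hWup : ∀ y ∈ W, ∀ u : ℝ, 0 ≤ u →
      (⟨(y : E4) + u • E4.basisVector 0, Kerr.add_smul_basisVector_zero_mem_region y.2 u⟩ : Kerr.region a M) ∈ W)
    (U : Opens (Kerr.spacetime M a M hM0.le).carrier)
    (hU : ∀ y : Kerr.region a M, y ∈ U ↔
      (σ ≤ (y : E4) 0 ∧ (y : E4) 0 < σ + hp ∧ ∀ z : E3, ‖z - E4.spatial (y : E4)‖ ≤ (y : E4) 0 - σ →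
        min (Kerr.radius a (y : E4)) (Kerr.rPlus M a) ≤ Kerr.radius a (E4.ofTimeSpace 0 z) → z ∈ (N : Set E3)) ∨
      (y ∈ W ∧ σ - hm < (y : E4) 0 ∧ (y : E4) 0 < σ ∧
        σ + 2 / 3 * M < (y : E4) 0 + 2 / 3 * Kerr.radius a (y : E4) ∧
        ∀ z : E3, ‖z - E4.spatial (y : E4)‖ ≤ σ - (y : E4) 0 → z ∈ (N : Set E3)))
    {jK : N → Kerr.region a M} (hjK : ∀ y, (jK y : E4) = E4.ofTimeSpace σ (y : E3))
    {νK : NormalField 𝓘(ℝ, E4) jK} (hνK : ∀ y, νK y = Kerr.sliceNormal M a M (Opens.inclusion hN y))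
    [ConnectedSpace N]
    {j : N → 𝒱.carrier} {ν : NormalField (𝓡 4) j}
    (hj : Manifold.IsSmoothEmbedding (𝓡 3) (𝓡 4) ∞ j)
    (hν : 𝒱.metric.IsFutureUnitNormal (𝓡 3) 𝒱.timeOrientation j ν)
    (hh : ∀ y : N, pullbackBilin (I := 𝓡 4) (I' := 𝓡 3) j 𝒱.metric.val y =
      ((Kerr.data M a M hM0.le).comap (Opens.inclusion hN) (contMDiff_inclusion hN)
        (KerrLevel.injective_mfderiv_inclusion hN)).h.inner y)
    (hk : ∀ [𝒱.metric.toPseudoRiemannianMetric.HasLeviCivita] (y : N),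
      𝒱.metric.toPseudoRiemannianMetric.secondFundamentalForm (𝓡 3) j ν y =
        ((Kerr.data M a M hM0.le).comap (Opens.inclusion hN) (contMDiff_inclusion hN)
          (KerrLevel.injective_mfderiv_inclusion hN)).kBilin y)
    -- the realised kite
    {Θ : U → 𝒱.carrier} (hΘs : ContMDiff 𝓘(ℝ, E4) (𝓡 4) ∞ Θ)
    (hΘi : ((Kerr.spacetime M a M hM0.le).metric.restrict PseudoRiemannianMetric.contMDiff_restrict_holds
        U).IsIsometricImmersion 𝒱.metric.toPseudoRiemannianMetric Θ)
    (hΘt : ((Kerr.spacetime M a M hM0.le).timeOrientation.restrict PseudoRiemannianMetric.contMDiff_restrict_holds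
        (Kerr.spacetime M a M hM0.le).timeOrientation.contMDiff_restrict_holds U).PreservesTimeOrientation
        Θ 𝒱.timeOrientation)
    (hΘj : ∀ (y : N) (h : jK y ∈ U), Θ ⟨jK y, h⟩ = j y)
    -- the old chart, as a map of the Kerr chart, on the sub-kite
    {Φ : Kerr.region a M → 𝒱.carrier}
    (hΦ : ∀ z : Kerr.region a M, z ∈ U → (z : E4) 0 < σ + hp' →
      ContMDiffAt 𝓘(ℝ, E4) (𝓡 4) ∞ Φ z ∧
      (∀ u u' : E4, 𝒱.metric.val (Φ z) (mfderiv 𝓘(ℝ, E4) (𝓡 4) Φ z u) (mfderiv 𝓘(ℝ, E4) (𝓡 4) Φ z u') =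
        Kerr.bilin M a z.1 u u') ∧
      𝒱.timeOrientation.IsFutureDirected (mfderiv 𝓘(ℝ, E4) (𝓡 4) Φ z (Kerr.timeVector M a z.1)))
    (hΦj : ∀ y : N, Φ (jK y) = j y) :
    ∀ z : U, (z.1.1 : E4) 0 < σ + hp' → Θ z = Φ z.1 := by
  -- the sub-kite `L = U ∩ {t* < σ + hp'}`, an open connected set containing the slice
  have hct : Continuous fun y : Kerr.region a M => (y : E4) 0 :=
    (PiLp.continuous_apply 2 (fun _ : Fin 4 => ℝ) 0).comp continuous_subtype_val
  set L : Opens (Kerr.spacetime M a M hM0.le).carrier :=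
    ⟨{z : Kerr.region a M | z ∈ U ∧ (z : E4) 0 < σ + hp'}, U.2.inter (isOpen_lt hct continuous_const)⟩ with hL_def
  have hLU : L ≤ U := fun z hz => hz.1
  have hL : ∀ y : Kerr.region a M, y ∈ L ↔
      (σ ≤ (y : E4) 0 ∧ (y : E4) 0 < σ + hp' ∧ ∀ z : E3, ‖z - E4.spatial (y : E4)‖ ≤ (y : E4) 0 - σ →
        min (Kerr.radius a (y : E4)) (Kerr.rPlus M a) ≤ Kerr.radius a (E4.ofTimeSpace 0 z) → z ∈ (N : Set E3)) ∨
      (y ∈ W ∧ σ - hm < (y : E4) 0 ∧ (y : E4) 0 < σ ∧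
        σ + 2 / 3 * M < (y : E4) 0 + 2 / 3 * Kerr.radius a (y : E4) ∧
        ∀ z : E3, ‖z - E4.spatial (y : E4)‖ ≤ σ - (y : E4) 0 → z ∈ (N : Set E3)) := by
    intro y
    change (y ∈ U ∧ (y : E4) 0 < σ + hp') ↔ _
    rw [hU y]
    constructor
    · rintro ⟨h | h, hlt⟩
      · exact Or.inl ⟨h.1, hlt, h.2.2⟩
      · exact Or.inr h
    · rintro (h | h)
      · exact ⟨Or.inl ⟨h.1, by linarith [h.2.1], h.2.2⟩, h.2.1⟩
      · exact ⟨Or.inr h, by linarith [h.2.2.1]⟩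
  -- the level data embedding and its restriction to `L`
  let 𝒮K : DataEmbedding ((Kerr.data M a M hM0.le).comap (Opens.inclusion hN) (contMDiff_inclusion hN)
      (KerrLevel.injective_mfderiv_inclusion hN)) :=
    { toSpacetime := Kerr.spacetime M a M hM0.le
      embed := jK
      isSmoothEmbedding := KerrLevel.level_isSmoothEmbedding hM0.le σ hN hjK
      normal := νK
      isFutureUnitNormal := KerrLevel.level_isFutureUnitNormal hM0.le σ hN hjK hνK
      induced_h := KerrLevel.level_induced_h hM0.le σ hN hjK
      induced_k := by
        intro inst y
        haveI : (Kerr.smoothMetric M a M).HasLeviCivita := inst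
        exact KerrLevel.level_induced_k hM0.le σ hN hjK hνK y }
  have hιL : ∀ y, 𝒮K.embed y ∈ L := fun y => (hL _).2 (level_mem_kite hhp' hjK y)
  have hSr : ∀ z ∈ (N : Set E3), E4.ofTimeSpace σ z ∈ Kerr.region a M := fun z hz => by
    rw [Kerr.mem_region, Kerr.radius_eq_of_spatial_eq a
      (show E4.spatial (E4.ofTimeSpace σ z) = E4.spatial (E4.ofTimeSpace 0 z) by
        rw [E4.spatial_ofTimeSpace, E4.spatial_ofTimeSpace])]
    exact Kerr.mem_slice_iff_ofTimeSpace_mem_region.1 (hN hz)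
  have hLconn : IsConnected (L : Set (Kerr.spacetime M a M hM0.le).carrier) := by
    have h := KerrKite.isConnected_kite (M := M) (a := a) (σ := σ) (hm := hm) (W := W) hhp' hNc hSr hWup
    have h' : (L : Set (Kerr.spacetime M a M hM0.le).carrier) = {y : Kerr.region a M |
      (σ ≤ (y : E4) 0 ∧ (y : E4) 0 < σ + hp' ∧ ∀ z : E3, ‖z - E4.spatial (y : E4)‖ ≤ (y : E4) 0 - σ →
        min (Kerr.radius a (y : E4)) (Kerr.rPlus M a) ≤ Kerr.radius a (E4.ofTimeSpace 0 z) → z ∈ (N : Set E3)) ∨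
      (y ∈ W ∧ σ - hm < (y : E4) 0 ∧ (y : E4) 0 < σ ∧
        σ + 2 / 3 * M < (y : E4) 0 + 2 / 3 * Kerr.radius a (y : E4) ∧
        ∀ z : E3, ‖z - E4.spatial (y : E4)‖ ≤ σ - (y : E4) 0 → z ∈ (N : Set E3))} :=
      Set.ext fun y => hL y
    rw [h']; exact h
  let 𝒮L := 𝒮K.restrict L hLconn hιL (KerrLevel.level_mdifferentiableAt_normal hM0.le σ hN hjK hνK)
  -- the `𝒱`-side data embedding
  let 𝒮V : DataEmbedding ((Kerr.data M a M hM0.le).comap (Opens.inclusion hN) (contMDiff_inclusion hN)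
      (KerrLevel.injective_mfderiv_inclusion hN)) :=
    { toSpacetime := 𝒱.toSpacetime
      embed := j
      isSmoothEmbedding := hj
      normal := ν
      isFutureUnitNormal := hν
      induced_h := hh
      induced_k := by
        intro inst y
        haveI : 𝒱.metric.toPseudoRiemannianMetric.HasLeviCivita := inst
        exact hk y }
  -- the two immersions `L → 𝒱`
  set ψ₁ : L → 𝒱.carrier := fun z => Θ ⟨z.1, hLU z.2⟩ with hψ₁
  set ψ₂ : L → 𝒱.carrier := fun z => Φ z.1 with hψ₂
  -- the inclusion `L → U` and its differential
  have hincl : ContMDiff 𝓘(ℝ, E4) 𝓘(ℝ, E4) ∞ (Opens.inclusion hLU : L → U) := contMDiff_inclusion hLU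
  have hdincl : ∀ z : L, mfderiv 𝓘(ℝ, E4) 𝓘(ℝ, E4) (Opens.inclusion hLU : L → U) z = ContinuousLinearMap.id ℝ E4 := by
    intro z
    have hι : MDifferentiableAt 𝓘(ℝ, E4) 𝓘(ℝ, E4) (Opens.inclusion hLU : L → U) z :=
      (hincl z).mdifferentiableAt (by simp)
    have hval : MDifferentiableAt 𝓘(ℝ, E4) 𝓘(ℝ, E4) (Subtype.val : U → Kerr.region a M) (Opens.inclusion hLU z) :=
      (contMDiff_subtype_val (n := ∞) _).mdifferentiableAt (by simp)
    have hcomp := mfderiv_comp z hval hι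
    rw [show ((Subtype.val : U → Kerr.region a M) ∘ Opens.inclusion hLU) = (Subtype.val : L → Kerr.region a M)
      from rfl, mfderiv_subtypeVal, mfderiv_subtypeVal] at hcomp
    rw [hcomp]; exact (ContinuousLinearMap.id_comp _).symm
  have hψ₁eq : ψ₁ = Θ ∘ Opens.inclusion hLU := rfl
  -- `ψ₁` is an isometric time-orientation preserving immersion of `𝒮L`
  have hΘd : MDifferentiable 𝓘(ℝ, E4) (𝓡 4) Θ := hΘs.mdifferentiable (by simp)
  have hdψ₁ : ∀ z : L, mfderiv 𝓘(ℝ, E4) (𝓡 4) ψ₁ z = mfderiv 𝓘(ℝ, E4) (𝓡 4) Θ (Opens.inclusion hLU z) := by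
    intro z
    rw [hψ₁eq, mfderiv_comp z (hΘd _) ((hincl z).mdifferentiableAt (by simp)), hdincl z]
    exact ContinuousLinearMap.comp_id _
  have hψ₁i : 𝒮L.metric.IsIsometricImmersion 𝒱.metric.toPseudoRiemannianMetric ψ₁ := by
    refine ⟨hΘs.comp hincl, fun z => ?_⟩
    ext u u'
    show 𝒱.metric.val (ψ₁ z) (mfderiv 𝓘(ℝ, E4) (𝓡 4) ψ₁ z u) (mfderiv 𝓘(ℝ, E4) (𝓡 4) ψ₁ z u') =
      Kerr.bilin M a z.1.1 u u'
    rw [hdψ₁ z]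
    have h := congrArg (fun b => b u u') (hΘi.2 (Opens.inclusion hLU z))
    simp only [pullbackBilin_apply] at h
    exact h
  have hψ₁c : ψ₁ ∘ 𝒮L.embed = 𝒮V.embed := by
    funext y
    exact hΘj y (hLU (hιL y))
  -- `ψ₂` is an isometric time-orientation preserving immersion of `𝒮L`
  have hΦz : ∀ z : L, ContMDiffAt 𝓘(ℝ, E4) (𝓡 4) ∞ Φ z.1 ∧
      (∀ u u' : E4, 𝒱.metric.val (Φ z.1) (mfderiv 𝓘(ℝ, E4) (𝓡 4) Φ z.1 u) (mfderiv 𝓘(ℝ, E4) (𝓡 4) Φ z.1 u') =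
        Kerr.bilin M a z.1.1 u u') ∧
      𝒱.timeOrientation.IsFutureDirected (mfderiv 𝓘(ℝ, E4) (𝓡 4) Φ z.1 (Kerr.timeVector M a z.1.1)) :=
    fun z => hΦ z.1 z.2.1 z.2.2
  have hdψ₂ : ∀ z : L, mfderiv 𝓘(ℝ, E4) (𝓡 4) ψ₂ z = mfderiv 𝓘(ℝ, E4) (𝓡 4) Φ z.1 := fun z =>
    mfderiv_comp_subtypeVal ((hΦz z).1.mdifferentiableAt (by simp))
  have hψ₂i : 𝒮L.metric.IsIsometricImmersion 𝒱.metric.toPseudoRiemannianMetric ψ₂ := by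
    refine ⟨fun z => (hΦz z).1.comp z (contMDiff_subtype_val z), fun z => ?_⟩
    ext u u'
    show 𝒱.metric.val (ψ₂ z) (mfderiv 𝓘(ℝ, E4) (𝓡 4) ψ₂ z u) (mfderiv 𝓘(ℝ, E4) (𝓡 4) ψ₂ z u') =
      Kerr.bilin M a z.1.1 u u'
    rw [hdψ₂ z]
    exact (hΦz z).2.1 u u'
  have hψ₂c : ψ₂ ∘ 𝒮L.embed = 𝒮V.embed := by
    funext y
    exact hΦj y
  -- rigidity (time orientation: `dψ₁ V = dΘ V`, `dψ₂ V = dΦ V` are future-directed)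
  have key : ψ₁ = ψ₂ := by
    refine DataEmbedding.eq_of_comp_embed_eq 𝒮L 𝒮V hψ₁i (fun z => ?_) hψ₁c hψ₂i (fun z => ?_) hψ₂c
    · show 𝒱.timeOrientation.IsFutureDirected (mfderiv 𝓘(ℝ, E4) (𝓡 4) ψ₁ z (Kerr.timeVector M a z.1.1))
      rw [hdψ₁ z]
      exact hΘt (Opens.inclusion hLU z)
    · show 𝒱.timeOrientation.IsFutureDirected (mfderiv 𝓘(ℝ, E4) (𝓡 4) ψ₂ z (Kerr.timeVector M a z.1.1))
      rw [hdψ₂ z]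
      exact (hΦz z).2.2
  intro z hz
  exact congrFun key ⟨z.1, z.2, hz⟩

end KiteRealise

/-- **Registered bookkeeping sub-goal `stub_kerrLevelMemKite` of the line** (brick of the landing of
K2b-5 `stub_marchingLemma`): the points `(σ, y)`, `y ∈ N`, of the level slice lie in the kite over
`{σ} × N` (anchor of this file, whose content is the realisation of the kite development inside the
maximal development, `KiteRealise.kite_realised`, and the rigidity `KiteRealise.kite_chart_unique`). [folklore] -/
theorem stub_kerrLevelMemKite : ∀ (M a σ hp hm : ℝ), 0 < hp → ∀ (N : Opens E3) (W : Set (Kerr.region a M))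
    (jK : N → Kerr.region a M), (∀ y, (jK y : E4) = E4.ofTimeSpace σ (y : E3)) → ∀ y : N,
    (σ ≤ (jK y : E4) 0 ∧ (jK y : E4) 0 < σ + hp ∧ ∀ z : E3, ‖z - E4.spatial (jK y : E4)‖ ≤ (jK y : E4) 0 - σ →
        min (Kerr.radius a (jK y : E4)) (Kerr.rPlus M a) ≤ Kerr.radius a (E4.ofTimeSpace 0 z) → z ∈ (N : Set E3)) ∨
      (jK y ∈ W ∧ σ - hm < (jK y : E4) 0 ∧ (jK y : E4) 0 < σ ∧
        σ + 2 / 3 * M < (jK y : E4) 0 + 2 / 3 * Kerr.radius a (jK y : E4) ∧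
        ∀ z : E3, ‖z - E4.spatial (jK y : E4)‖ ≤ σ - (jK y : E4) 0 → z ∈ (N : Set E3)) :=
  fun _ _ _ _ _ hhp _ _ _ hjK y => KiteRealise.level_mem_kite hhp hjK y

end Summit.FinalStateConjecture.FinalStateConjecture.Theorems.BondiBartnikRigidity.DirectMethod

end
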